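import Mathlib
import HarnessLib.Audit
import Summits.PneNP.PneNP.Theorems.PstarChordSystem

/-!
# Change of constraint basis for a chord system: the `GL₂(𝔽₂)` step of R5 (ROUND-24, memo §7 G2′ / §9 R5 / §10 "single-read basis")

FRONTIER range-avoidance ladder, rung F-N3, ROUND 24 (cell `pnp-ideate`, planner memo `r24/CORE-BOUND-NOTES.md` §7 G2′ ("after a `GL₂` change of
constraint basis `{w₁,w₂} ↦ {w₁+w₂, w₂}`, which preserves feasibility and minimality, the core is in the single-read regime") and §10; restricted-model
proof complexity — nothing here bears on `P` versus `NP`).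

`PstarChordSystem.direction_collapse` (R5) leaves a chord system whose read vectors all lie on ONE line `{0, m}` of `𝔽₂²` (case (U1)); the single-read
theorems (`forced_of_read`, `star_star`, `PstarChordForcing.forced_chord_cases`) want that line to be `{0, (1,0)}`.  This file supplies the basis
change, mechanism-free:

* `mapSys S φ` — push the two constraints of a chord system through an additive map `φ : 𝔽₂² →+ 𝔽₂²` (read vectors, state-free part and target are
  mapped; prescribed products are unchanged); `mapSys_val`, `mapSys_adm`;
* `infeasible_mapSys` (for injective `φ`), `chordMinimal_mapSys`, `const_mapSys` — infeasibility, chord-minimality and constancy of reads transport;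
* `toX m` — for `m ≠ 0` an INJECTIVE additive map with `(toX m v).2 = ω(v, m) := v₁m₂ + v₂m₁` (the symplectic pairing), so `toX m` kills the second
  coordinate exactly on the line `{0, m}`: `singleRead_mapSys_toX` — a (U1) system becomes SINGLE-READ;
* `mapSys_toX_q` — the new second constraint is `q(a) = m₂·(F₁(a) + t₁) + m₁·(F₂(a) + t₂)`, i.e. `w₂` itself (`m = (1,0)`), `w₁` (`m = (0,1)`) or
  `w₁ + w₂` (`m = (1,1)`).
-/

set_option linter.dupNamespace false -- `Summit.PneNP.PneNP.…`: summit = sub-problem name (D-0017 single-conjunct layout)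

open Finset
open Summit.PneNP.PneNP.Theorems.PstarReadSumset (V2)
open Summit.PneNP.PneNP.Theorems.PstarChordSystem (ChordSystem)

namespace Summit.PneNP.PneNP.Theorems.PstarChordSystemMap

variable {ι A : Type*}

/-! ## Pushing a chord system through an additive map of `𝔽₂²` -/

/-- The chord system with both constraints pushed through `φ`. -/
def mapSys (S : ChordSystem ι A) (φ : V2 →+ V2) : ChordSystem ι A where
  u := S.u
  ρ e a := φ (S.ρ e a)
  ρ' e a := φ (S.ρ' e a)
  F a := φ (S.F a)
  t := φ S.t

/-- Unfolding. -/
@[simp] theorem mapSys_u (S : ChordSystem ι A) (φ : V2 →+ V2) : (mapSys S φ).u = S.u := rfl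
/-- Unfolding. -/
@[simp] theorem mapSys_ρ (S : ChordSystem ι A) (φ : V2 →+ V2) (e : ι) (a : A) : (mapSys S φ).ρ e a = φ (S.ρ e a) := rfl
/-- Unfolding. -/
@[simp] theorem mapSys_ρ' (S : ChordSystem ι A) (φ : V2 →+ V2) (e : ι) (a : A) : (mapSys S φ).ρ' e a = φ (S.ρ' e a) := rfl
/-- Unfolding. -/
@[simp] theorem mapSys_F (S : ChordSystem ι A) (φ : V2 →+ V2) (a : A) : (mapSys S φ).F a = φ (S.F a) := rfl
/-- Unfolding. -/
@[simp] theorem mapSys_t (S : ChordSystem ι A) (φ : V2 →+ V2) : (mapSys S φ).t = φ S.t := rfl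

/-- Additive maps of `𝔽₂`-modules commute with the `𝔽₂`-action (the scalars are `0` and `1`). -/
theorem smul_map (φ : V2 →+ V2) (c : ZMod 2) (v : V2) : c • φ v = φ (c • v) := by
  have hc : c = 0 ∨ c = 1 := by revert c; decide
  rcases hc with rfl | rfl
  · rw [zero_smul, zero_smul, map_zero]
  · rw [one_smul, one_smul]

/-- Contributions are mapped. -/
theorem mapSys_contrib (S : ChordSystem ι A) (φ : V2 →+ V2) (a : A) (s : ι → ZMod 2 × ZMod 2) (e : ι) :
    (mapSys S φ).contrib a s e = φ (S.contrib a s e) := by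
  unfold ChordSystem.contrib
  rw [map_add, mapSys_ρ, mapSys_ρ', smul_map, smul_map]

/-- **Constraint values are mapped.** -/
theorem mapSys_val (S : ChordSystem ι A) (φ : V2 →+ V2) (E : Finset ι) (a : A) (s : ι → ZMod 2 × ZMod 2) :
    (mapSys S φ).val E a s = φ (S.val E a s) := by
  unfold ChordSystem.val
  rw [map_add, map_sum, mapSys_F]
  exact congrArg _ (sum_congr rfl fun e _ => mapSys_contrib S φ a s e)

/-- Admissibility is unchanged (the prescribed products are not touched). -/
theorem mapSys_adm (S : ChordSystem ι A) (φ : V2 →+ V2) (E : Finset ι) (a : A) (s : ι → ZMod 2 × ZMod 2) :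
    (mapSys S φ).Adm E a s ↔ S.Adm E a s := Iff.rfl

/-- **Infeasibility transports** along an injective change of basis. -/
theorem infeasible_mapSys (S : ChordSystem ι A) {φ : V2 →+ V2} (hφ : Function.Injective φ) {E : Finset ι} (h : S.Infeasible E) :
    (mapSys S φ).Infeasible E := by
  intro a s hadm hval
  rw [mapSys_val, mapSys_t] at hval
  exact h a s ((mapSys_adm S φ E a s).1 hadm) (hφ hval)

/-- **Chord-minimality transports** (any additive map). -/
theorem chordMinimal_mapSys [DecidableEq ι] (S : ChordSystem ι A) (φ : V2 →+ V2) {E : Finset ι} {e : ι} (h : S.ChordMinimal E e) :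
    (mapSys S φ).ChordMinimal E e := by
  obtain ⟨a, s, hadm, hval⟩ := h
  exact ⟨a, s, (mapSys_adm S φ _ a s).2 hadm, by rw [mapSys_val, mapSys_t, hval]⟩

/-- Constancy of the read vectors transports. -/
theorem const_mapSys (S : ChordSystem ι A) (φ : V2 →+ V2) (h : ∀ e a a', S.ρ e a = S.ρ e a' ∧ S.ρ' e a = S.ρ' e a') :
    ∀ e a a', (mapSys S φ).ρ e a = (mapSys S φ).ρ e a' ∧ (mapSys S φ).ρ' e a = (mapSys S φ).ρ' e a' := fun e a a' => by
  simp only [mapSys_ρ, mapSys_ρ', (h e a a').1, (h e a a').2, and_self]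

/-! ## The map sending a direction `m ≠ 0` to `(1,0)` -/

/-- The symplectic pairing `ω(v, w) = v₁w₂ + v₂w₁` on `𝔽₂²` (`ω(v,v) = 0`, and `ω(m,m') = 1` for distinct non-zero `m, m'`). -/
def omega (v w : V2) : ZMod 2 := v.1 * w.2 + v.2 * w.1

/-- A non-zero vector other than `m` (for `m ≠ 0`). -/
def partner (m : V2) : V2 := if m = (1, 0) then (0, 1) else (1, 0)

/-- **The basis change `toX m`**: `v ↦ (ω(v, partner m), ω(v, m))`. -/
def toX (m : V2) : V2 →+ V2 where
  toFun v := (omega v (partner m), omega v m)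
  map_zero' := by simp [omega]
  map_add' v w := by
    simp only [omega, Prod.fst_add, Prod.snd_add, Prod.mk_add_mk]
    refine Prod.ext ?_ ?_ <;> simp only <;> ring

/-- The second coordinate after the basis change is the pairing with `m`. -/
theorem toX_snd (m v : V2) : (toX m v).2 = v.1 * m.2 + v.2 * m.1 := rfl

/-- `toX m` kills the second coordinate of `m` … -/
theorem toX_self_snd (m : V2) : (toX m m).2 = 0 := by
  rw [toX_snd]
  obtain ⟨a, b⟩ := m
  simp only
  revert a b; decide

/-- … and of `0`. -/
theorem toX_zero (m : V2) : toX m 0 = 0 := map_zero _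

/-- **`toX m` is injective** for `m ≠ 0`. -/
theorem toX_injective {m : V2} (hm : m ≠ 0) : Function.Injective (toX m) := by
  intro v w h
  have h1 := congrArg Prod.fst h
  have h2 := congrArg Prod.snd h
  change omega v (partner m) = omega w (partner m) at h1
  change omega v m = omega w m at h2
  unfold omega at h1 h2
  unfold partner at h1
  obtain ⟨a, b⟩ := m
  obtain ⟨v₁, v₂⟩ := v
  obtain ⟨w₁, w₂⟩ := w
  revert a b v₁ v₂ w₁ w₂
  decide

/-- **A (U1) system becomes single-read**: if every read vector lies on the line `{0, m}`, then after `toX m` the second constraint reads nothing. -/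
theorem singleRead_mapSys_toX (S : ChordSystem ι A) {m : V2}
    (hU1 : ∀ e a, (S.ρ e a = 0 ∨ S.ρ e a = m) ∧ (S.ρ' e a = 0 ∨ S.ρ' e a = m)) : (mapSys S (toX m)).SingleRead := by
  intro e a
  refine ⟨?_, ?_⟩
  · rw [mapSys_ρ]
    rcases (hU1 e a).1 with h | h
    · rw [h, toX_zero]; rfl
    · rw [h]; exact toX_self_snd m
  · rw [mapSys_ρ']
    rcases (hU1 e a).2 with h | h
    · rw [h, toX_zero]; rfl
    · rw [h]; exact toX_self_snd m

/-- **The new second constraint**: `q(a) := (F'(a)).2 + t'.2 = m₂·(F₁(a) + t₁) + m₁·(F₂(a) + t₂)`. -/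
theorem mapSys_toX_q (S : ChordSystem ι A) (m : V2) (a : A) :
    ((mapSys S (toX m)).F a).2 + (mapSys S (toX m)).t.2 = m.2 * ((S.F a).1 + S.t.1) + m.1 * ((S.F a).2 + S.t.2) := by
  rw [mapSys_F, mapSys_t, toX_snd, toX_snd]
  ring

/-- The three directions: `m = (1,0)` keeps `w₂`, `m = (0,1)` takes `w₁`, `m = (1,1)` takes `w₁ + w₂` as the new second constraint. -/
theorem mapSys_toX_q_cases (S : ChordSystem ι A) (a : A) :
    ((mapSys S (toX (1, 0))).F a).2 + (mapSys S (toX (1, 0))).t.2 = (S.F a).2 + S.t.2 ∧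
    ((mapSys S (toX (0, 1))).F a).2 + (mapSys S (toX (0, 1))).t.2 = (S.F a).1 + S.t.1 ∧
    ((mapSys S (toX (1, 1))).F a).2 + (mapSys S (toX (1, 1))).t.2 = ((S.F a).1 + S.t.1) + ((S.F a).2 + S.t.2) := by
  refine ⟨?_, ?_, ?_⟩ <;> rw [mapSys_toX_q] <;> simp

/-! ## R5 ⟹ single-read, packaged -/

/-- **After direction collapse (U1), the basis-changed system is single-read, infeasible, chord-minimal where the original was, with constant
reads if the original had them** — ready for `PstarChordSystem.star_star` / `PstarChordForcing.forced_chord_cases`. -/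
theorem U1_package [DecidableEq ι] (S : ChordSystem ι A) {E : Finset ι} (hI : S.Infeasible E) {m : V2} (hm : m ≠ 0)
    (hU1 : ∀ e a, (S.ρ e a = 0 ∨ S.ρ e a = m) ∧ (S.ρ' e a = 0 ∨ S.ρ' e a = m))
    (hconst : ∀ e a a', S.ρ e a = S.ρ e a' ∧ S.ρ' e a = S.ρ' e a') :
    (mapSys S (toX m)).SingleRead ∧ (mapSys S (toX m)).Infeasible E ∧
      (∀ e, S.ChordMinimal E e → (mapSys S (toX m)).ChordMinimal E e) ∧
      (∀ e a a', (mapSys S (toX m)).ρ e a = (mapSys S (toX m)).ρ e a' ∧ (mapSys S (toX m)).ρ' e a = (mapSys S (toX m)).ρ' e a') :=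
  ⟨singleRead_mapSys_toX S hU1, infeasible_mapSys S (toX_injective hm) hI, fun _ h => chordMinimal_mapSys S _ h, const_mapSys S _ hconst⟩

end Summit.PneNP.PneNP.Theorems.PstarChordSystemMap
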